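import Summits.Langlands.Langlands.Statement
import Literature.NumberTheory.Automorphic.PDAutomorphyLiftingGL2TotallyReal
import HarnessLib

/-!
# On-path lemma (F4) for the rung `CyclotomicDihedralLiftingTR = ResidualImageLiftingTR 1`
# (crux `ReciprocityUpToIrreducibility`, item stmt-Langlands-14328; G4 ladder-down, generation 10)

`Langlands → ResidualImageLiftingTR θ` for EVERY `θ` (in particular the rung `θ = 1` and the higher rungs
`θ = 2, 3`): clause (B) of the summit at any reciprocity datum — one exists by the `Nonempty` conjunct of
the Statement — applies to every `ρ` on the sector, because the sector's crystalline clause is stated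
against the PINNED Fontaine datum `fontainePstAdicCompletion v p hv`, which is `Rec.pst p v hv` by
definition (`ReciprocityData.pst`), and crystalline ⇒ de Rham (`IsCrystallineFramed.isDeRhamFramed`), so
the sector hypotheses give `IsGeometricFramed Rec ρ`; `Corresponds Rec ι π ρ` contains a.e.
Satake–Frobenius matching (`m = 1`) as its first conjunct.  The residual hypotheses (the dialled clause),
oddness, `p ≥ 7`, `p ∤ d_F` and potential diagonalizability are not used (a lifting theorem is a SECTOR
of (B)).  Also the dial monotonicity `E(3) → E(2) → E(1)`.  The family is VERBATIM the one of
`Lines/CyclotomicDihedralLiftingTR.lean`.  Sorry-free; standard axioms.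
-/

noncomputable section

set_option linter.dupNamespace false

open scoped MatrixGroups Matrix NumberField Classical
open NumberField IsDedekindDomain Field Filter
open Literature.NumberTheory.Automorphic Literature.NumberTheory.GaloisRepresentations
open Literature.NumberTheory.PAdicHodge
open Summit.Langlands

namespace Summit.Langlands.Langlands.Cruxes.ReciprocityUpToIrreducibility.CyclotomicDihedralLiftingTR.OnPath

/-! ## The sector clauses (verbatim from `BLGGT2014_thm421_GL2_totallyReal`) -/

/-- `ρ|Γ_{F_v}` is CRYSTALLINE for the PINNED Fontaine datum with two distinct `τ`-labelled Hodge–Tate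
weights for every `ℚ_p`-label `τ`, at every `v ∣ p` (the fact's local clause, verbatim). -/
def CrystallineRegularAt {F : Type} [Field F] [NumberField F] (p : ℕ) [Fact p.Prime]
    (ρ : FramedGaloisRep F (PadicAlgCl p) 2) : Prop :=
  ∀ (v : HeightOneSpectrum (𝓞 F)) (hv : ((p : ℕ) : 𝓞 F) ∈ v.asIdeal),
    let D := fontainePstAdicCompletion v p hv
    D.IsCrystallineFramed (ρ.toLocal v) ∧
    (letI := D.algebra
     ∀ τ : v.adicCompletion F →ₐ[ℚ_[p]] PadicAlgCl p,
      let M := ρ.labelledHodgeTateWeightsAt v D.algebra D.𝔅 τ.toRingHom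
      M.Nodup ∧ Multiset.card M = 2)

/-- `ρ|Γ_{F_v}` is POTENTIALLY DIAGONALIZABLE at every `v ∣ p`, relative to every instance of compatible
crystalline extension data over the pinned datum, such instances existing (the fact's clause, verbatim). -/
def PotentiallyDiagonalizableAt {F : Type} [Field F] [NumberField F] (p : ℕ) [Fact p.Prime]
    (ρ : FramedGaloisRep F (PadicAlgCl p) 2) : Prop :=
  ∀ (v : HeightOneSpectrum (𝓞 F)) (hv : ((p : ℕ) : 𝓞 F) ∈ v.asIdeal),
    Nonempty (PstCrystallineExtensionData (fontainePstAdicCompletion v p hv)) ∧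
    ∀ 𝔈 : PstCrystallineExtensionData (fontainePstAdicCompletion v p hv),
      letI := (fontainePstAdicCompletion v p hv).algebra
      IsPotentiallyDiagonalizable 𝔈.𝔅 (ρ.toLocal v)

/-! ## The residual clauses (the dialled hypothesis) -/

/-- **The Taylor–Wiles hypothesis** (residual depth `0`): `ρ̄|Γ_{F(ζ_p)}` is absolutely irreducible —
trace rendering: `tr ρ̄|Γ_{F(ζ_p)}` is not the sum of two finite-order characters (the fact's `hbig`). -/
def TaylorWilesHypothesis (F : Type) [Field F] [NumberField F] (p : ℕ) [Fact p.Prime]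
    (ρ : FramedGaloisRep F (PadicAlgCl p) 2) : Prop :=
  ¬ ∃ χ₁ χ₂ : absoluteGaloisGroup (CyclotomicField p F) →* (PadicAlgCl p)ˣ,
      IsOpen (χ₁.ker : Set (absoluteGaloisGroup (CyclotomicField p F))) ∧
      IsOpen (χ₂.ker : Set (absoluteGaloisGroup (CyclotomicField p F))) ∧
      ∀ σ, ‖(ρ.restrictField (CyclotomicField p F) σ).val.trace -
        ((χ₁ σ : PadicAlgCl p) + (χ₂ σ : PadicAlgCl p))‖ < 1

/-- **`ρ̄` absolutely irreducible over `F`** (residual depth `≤ 1`): `tr ρ̄` is not the sum of two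
finite-order characters of `Γ_F` (same rendering, over `F` instead of `F(ζ_p)`).  Given this, the
Taylor–Wiles hypothesis fails exactly when `ρ̄ ≅ Ind_{Γ_K}^{Γ_F} χ̄` for the quadratic subfield
`K ⊂ F(ζ_p)` — the CYCLOTOMIC-DIHEDRAL residual images. [cite: Thorne2016, §1] -/
def ResiduallyAbsIrreducible (F : Type) [Field F] [NumberField F] (p : ℕ) [Fact p.Prime]
    (ρ : FramedGaloisRep F (PadicAlgCl p) 2) : Prop :=
  ¬ ∃ χ₁ χ₂ : absoluteGaloisGroup F →* (PadicAlgCl p)ˣ,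
      IsOpen (χ₁.ker : Set (absoluteGaloisGroup F)) ∧
      IsOpen (χ₂.ker : Set (absoluteGaloisGroup F)) ∧
      ∀ σ, ‖(ρ σ).val.trace - ((χ₁ σ : PadicAlgCl p) + (χ₂ σ : PadicAlgCl p))‖ < 1

/-- **Residually PD-automorphic of level prime to `p`** (residual depth `≤ 2`, demanded only of
absolutely irreducible `ρ̄`): the fact's witness clause verbatim — a cuspidal `π₀`, L-algebraic with a
regular infinity type, unramified above `p`, attached a.e. to some `ρ₀ ≡ ρ (mod 𝔪)` (traces) that is
potentially diagonalizable above `p`. -/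
def ResiduallyPDAutomorphic (F : Type) [Field F] [NumberField F] (p : ℕ) [Fact p.Prime]
    (hcpt : isCompact_glFiniteIntegralLevel 2 F) (ι : PadicAlgCl p ≃+* ℂ)
    (ρ : FramedGaloisRep F (PadicAlgCl p) 2) : Prop :=
  ∃ (π₀ : CuspidalAutomorphicRepData 2 F hcpt) (ρ₀ : FramedGaloisRep F (PadicAlgCl p) 2),
    π₀.1.IsLAlgebraic ∧ (∃ T : InfinityType F 2, π₀.1.HasInfinityType T ∧ T.IsRegular) ∧
    SatakeFrobCompatibleAE ι π₀.1 ρ₀ ∧ (∀ σ, ‖(ρ σ).val.trace - (ρ₀ σ).val.trace‖ < 1) ∧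
    (∀ v : HeightOneSpectrum (𝓞 F), ((p : ℕ) : 𝓞 F) ∈ v.asIdeal → π₀.1.IsUnramifiedAt v) ∧
    ∀ (v : HeightOneSpectrum (𝓞 F)) (hv : ((p : ℕ) : 𝓞 F) ∈ v.asIdeal)
      (𝔈 : PstCrystallineExtensionData (fontainePstAdicCompletion v p hv)),
      letI := (fontainePstAdicCompletion v p hv).algebra
      IsPotentiallyDiagonalizable 𝔈.𝔅 (ρ₀.toLocal v)

/-! ## The family and the rung -/

/-- **The rung family** `E(θ)` — residual-image depth `θ` in PD-crystalline automorphy lifting for `GL₂`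
over totally real `F` (`p ≥ 7`, `p ∤ d_F`; `ρ : Γ_F → GL₂(ℚ̄_p)` irreducible, a.e. unramified, totally
odd, `CrystallineRegularAt`, `PotentiallyDiagonalizableAt`), residual clauses `θ = 0 →` Taylor–Wiles
hypothesis, `θ ≤ 1 →` `ρ̄` absolutely irreducible, `θ ≤ 2 →` (absolutely irreducible `ρ̄` is residually
PD-automorphic); conclusion: `ρ` is automorphic — an L-algebraic cuspidal `π` of `GL₂(𝔸_F)` with
`SatakeFrobCompatibleAE ι π ρ`.  `θ = 0`: BLGGT 4.2.1 / Dieulefait–Pacetti 8.11 (the tree's named fact: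
FLOOR); `θ = 1`: THE RUNG (print: weight `{0,1}` — Thorne 2016 Thm 1.2, Kalyanswamy 2018 Thm 1.1;
ordinary — Skinner–Wiles 2001; `F = ℚ` — Pan 2022 / Zhang 2025; OPEN otherwise); `θ = 2`: + residually
reducible (OPEN off `F = ℚ` / ordinary-abelian); `θ ≥ 3`: + Serre's conjecture over `F` (OPEN).
[cite: BarnetlambEtAl2014, Thm. 4.2.1] [cite: DieulefaitPacetti2015, Thm. 8.11] [cite: Thorne2016, Thm. 1.2] -/
def ResidualImageLiftingTR (θ : ℕ) : Prop :=
  ∀ (F : Type) [Field F] [NumberField F], IsTotallyReal F → ∀ (p : ℕ) [Fact p.Prime], 7 ≤ p →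
    ¬ ((p : ℤ) ∣ NumberField.discr F) →
    ∀ (hcpt : isCompact_glFiniteIntegralLevel 2 F) (ι : PadicAlgCl p ≃+* ℂ)
      (ρ : FramedGaloisRep F (PadicAlgCl p) 2),
      ρ.toGaloisRep.IsIrreducible →
      (∀ᶠ v : HeightOneSpectrum (𝓞 F) in cofinite, ρ.IsUnramifiedAt v) →
      ρ.IsOdd →
      CrystallineRegularAt p ρ →
      PotentiallyDiagonalizableAt p ρ →
      (θ = 0 → TaylorWilesHypothesis F p ρ) →
      (θ ≤ 1 → ResiduallyAbsIrreducible F p ρ) →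
      (θ ≤ 2 → ResiduallyAbsIrreducible F p ρ → ResiduallyPDAutomorphic F p hcpt ι ρ) →
      ∃ π : CuspidalAutomorphicRepData 2 F hcpt, π.1.IsLAlgebraic ∧ SatakeFrobCompatibleAE ι π.1 ρ

/-- **THE RUNG** (the filed statement): the family at `θ = 1` — PD-crystalline automorphy lifting for
`GL₂` over totally real fields WITHOUT the Taylor–Wiles hypothesis (`ρ̄` absolutely irreducible over `F`,
`ρ̄|Γ_{F(ζ_p)}` arbitrary: the cyclotomic-dihedral residual images admitted). -/
def CyclotomicDihedralLiftingTR : Prop := ResidualImageLiftingTR 1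

/-! ## Dial monotonicity -/

/-- The dial is monotone: a deeper rung implies every shallower one. -/
theorem mono {θ θ' : ℕ} (hle : θ ≤ θ') (h : ResidualImageLiftingTR θ') : ResidualImageLiftingTR θ := by
  intro F _ _ hF p _ hp hdisc hcpt ι ρ hirr hunr hodd hcrys hpd hbig hirrF hmod
  exact h F hF p hp hdisc hcpt ι ρ hirr hunr hodd hcrys hpd (fun h0 => hbig (by omega))
    (fun h1 => hirrF (by omega)) (fun h2 => hmod (by omega))

theorem mono_two_one (h : ResidualImageLiftingTR 2) : CyclotomicDihedralLiftingTR := mono (by norm_num) h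

theorem mono_three_two (h : ResidualImageLiftingTR 3) : ResidualImageLiftingTR 2 := mono (by norm_num) h

/-! ## On-path: the summit implies every rung -/

/-- **ON-PATH** (F4): `Langlands → E(θ)` for EVERY `θ`: clause (B) of the summit at any reciprocity datum
(one exists by the `Nonempty` conjunct) applies to every `ρ` of the sector — the crystalline clause is
stated against the PINNED Fontaine datum `fontainePstAdicCompletion v p hv = Rec.pst p v hv` (`rfl`) and
crystalline ⇒ de Rham (`IsCrystallineFramed.isDeRhamFramed`), so the sector gives `IsGeometricFramed Rec ρ`;
`Corresponds Rec ι π ρ` contains `SatakeFrobCompatibleAE ι π ρ` as its first conjunct.  The residual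
clauses are not used (a lifting theorem is a SECTOR of clause (B)). -/
theorem residualImageLiftingTR_of_langlands (θ : ℕ) (hL : _root_.Langlands) :
    ResidualImageLiftingTR θ := by
  intro F _ _ _hF p _ _hp _hdisc hcpt ι ρ hirr hunr _hodd hcrys _hpd _hbig _hirrF _hmod
  obtain ⟨⟨Rec⟩, hall⟩ := hL F
  have hB : GaloisToAutomorphic 2 Rec hcpt := (hall Rec 2 two_pos hcpt).2
  have hdR : ∀ (v : HeightOneSpectrum (𝓞 F)) (hv : ((p : ℕ) : 𝓞 F) ∈ v.asIdeal),
      (Rec.pst p v hv).IsDeRhamFramed (ρ.toLocal v) := by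
    intro v hv
    change (fontainePstAdicCompletion v p hv).IsDeRhamFramed (ρ.toLocal v)
    exact (hcrys v hv).1.isDeRhamFramed
  have hgeo : IsGeometricFramed Rec ρ := ⟨hunr, hdR⟩
  obtain ⟨π, hπL, hcorr⟩ := hB p ι ρ hirr hgeo
  refine ⟨π, hπL, ?_⟩
  filter_upwards [hcorr.1] with v hv
  exact hv

/-- **F4 on-path lemma for the rung**: `Langlands → CyclotomicDihedralLiftingTR`. -/
@[aesop safe apply]
theorem CyclotomicDihedralLiftingTR_of_Langlands (hL : _root_.Langlands) : CyclotomicDihedralLiftingTR :=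
  residualImageLiftingTR_of_langlands 1 hL

example : _root_.Langlands → CyclotomicDihedralLiftingTR := by intro h; aesop

end Summit.Langlands.Langlands.Cruxes.ReciprocityUpToIrreducibility.CyclotomicDihedralLiftingTR.OnPath

end
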